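import Summits.NavierStokesRegularity.NavierStokesRegularity.Theorems.ExtremiserTransienceNearExtremalTransienceExtremiserLiouvilleConstantSpeedBlowDownPairing
import Summits.NavierStokesRegularity.NavierStokesRegularity.Theorems.ExtremiserTransienceNearExtremalTransienceExtremiserLiouvilleConstantSpeedMultiplierStrongEL
import Literature.Analysis.FluidPDE.LocalBiotSavartCalculus
import HarnessLib

/-!
# Crux `ExtremiserTransience.NearExtremalTransience` (stmt-NavierStokesRegularity-21883), line `extremiser_liouville`,
# stub K1b — THE BLOW-DOWN PAIRING LAW, DISTRIBUTIONAL FORM: `κ⋆²M²W · R⁻²∫⟪v − c, (ΔΨ)(x/R)⟫ → ⟪Ψ(0), b⟫`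

`--supports stmt-NavierStokesRegularity-21883` (helper).  Author: prover seat `ns-el-k1b` (g5).  Continues
`…ConstantSpeedBlowDownPairing` (`κ⋆²M²W·a₁(Ψ(R⁻¹·)) → −⟪Ψ(0), b⟫`, `b = ∫v dμ`).

* `A1_eq_integral_inner_sub_curl_curl` : `a₁(φ) = ∫⟪curl v, curl φ⟫ = ∫⟪v − c, curl curl φ⟫` for solenoidal... for every
  `φ ∈ C_c^∞` and every constant `c` (curl adjointness, `curl c = 0`);
* `curl_curl_rescale` : `curl curl (Ψ(R⁻¹·))(x) = R⁻²·(curl curl Ψ)(R⁻¹x)`;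
* `tendsto_blowDown_curlCurl_pairing` : **`κ⋆²M²W · R⁻² ∫⟪v x − c, (curl curl Ψ)(R⁻¹x)⟫dx → −∫⟪v, Ψ(0)⟫dμ`**;
* `tendsto_blowDown_laplacian_pairing` : for divergence-free `Ψ` (`curl curl Ψ = −ΔΨ`, Mathlib's Laplacian):
  **`κ⋆²M²W · R⁻² ∫⟪v x − c, (ΔΨ)(R⁻¹x)⟫dx → ∫⟪v, Ψ(0)⟫dμ = ⟪Ψ(0), b⟫`.**
  Substituting `x = Ry`: `R⁻²∫⟪(v − c)(x), (ΔΨ)(x/R)⟫dx = ∫⟪V_R(y), ΔΨ(y)⟫dy` with the degree-`(−1)` blow-down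
  `V_R(y) = R·(v − c)(Ry)`; so **`κ⋆²M²W·ΔV_R → b·δ₀` in `𝒟′` modulo gradients**: every distributional blow-down limit `V_∞`
  solves the Stokes system `κ⋆²M²W ΔV_∞ − ∇π = b δ₀`, i.e. is the STOKESLET of force `b/(κ⋆²M²W)` plus an entire Stokes
  field (record §6: for the residue jet `V_R` is `L²_loc`-bounded and horizontal in the limit, forcing `b = 0`).

WHAT THIS IS NOT: K1b is NOT proved; nothing here proves NS regularity. [folklore]
-/

noncomputable section

open Set Filter Topology MeasureTheory Metric Function
open scoped ENNReal NNReal Topology InnerProductSpace RealInnerProductSpace ContDiff Laplacian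
open Literature.Analysis.FluidPDE Literature.Analysis

namespace Summit.NavierStokesRegularity.NavierStokesRegularity.Theorems

-- the problem directory repeats the summit name (`NavierStokesRegularity/NavierStokesRegularity`)
set_option linter.dupNamespace false

namespace ExtremiserLiouville

open DepletionLadder.KStar DepletionLadder.KStar.HalfSpace

variable {v φ Ψ : E3 → E3}

/-! ## `a₁(φ) = ∫⟪v − c, curl curl φ⟫` -/

/-- `curl φ` has compact support when `φ` has. [folklore] -/
theorem hasCompactSupport_curl_of (hφc : HasCompactSupport φ) : HasCompactSupport (curl φ) := by
  rw [curl_eq_curlCLM_comp]; exact (hφc.fderiv (𝕜 := ℝ)).comp_left (map_zero _)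

/-- **`a₁(φ) = ∫⟪v − c, curl curl φ⟫`** for `v` smooth, `φ ∈ C_c^∞` and any constant `c` (curl adjointness twice... once, and
`∫⟪c, curl curl φ⟫ = ∫⟪curl c, curl φ⟫ = 0`). [folklore] -/
theorem A1_eq_integral_inner_sub_curl_curl (hv : ContDiff ℝ ∞ v) (hφ : ContDiff ℝ ∞ φ) (hφc : HasCompactSupport φ)
    (c : E3) : A1 v φ = ∫ x, ⟪v x - c, curl (curl φ) x⟫_ℝ := by
  have hcφ : ContDiff ℝ ∞ (curl φ) := contDiff_curl hφ
  have hcφc : HasCompactSupport (curl φ) := hasCompactSupport_curl_of hφc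
  have hccφc : HasCompactSupport (curl (curl φ)) := hasCompactSupport_curl_of hcφc
  have hccφ : Continuous (curl (curl φ)) := continuous_curl (hcφ.of_le (by norm_cast))
  -- curl adjointness with `F = v` and with `F = c`
  have h1 : ∫ x, ⟪curl v x, curl φ x⟫_ℝ = ∫ x, ⟪v x, curl (curl φ) x⟫_ℝ :=
    integral_inner_curl_eq_of_contDiffOn isOpen_univ hv.contDiffOn hcφ hcφc (subset_univ _)
  -- the curl of the constant field `c` vanishes (cf. `ContinuousAlignmentCriterion.Negative.curl_const`)
  have hcc : ∀ x, curl (fun _ : E3 => c) x = 0 := fun x => by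
    rw [curl_eq_curlCLM, fderiv_fun_const, Pi.zero_apply]; exact map_zero _
  have h2 : ∫ x, ⟪c, curl (curl φ) x⟫_ℝ = 0 := by
    have h := integral_inner_curl_eq_of_contDiffOn isOpen_univ (contDiff_const (c := c)).contDiffOn hcφ hcφc
      (subset_univ _)
    rw [← h]
    simp only [hcc, inner_zero_left, integral_zero]
  have i1 : Integrable (fun x => ⟪v x, curl (curl φ) x⟫_ℝ) volume :=
    ((hv.continuous.inner hccφ).integrable_of_hasCompactSupport
      (hccφc.mono fun x hx => by
        rw [mem_support] at hx ⊢
        contrapose! hx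
        rw [hx, inner_zero_right]))
  have i2 : Integrable (fun x => ⟪c, curl (curl φ) x⟫_ℝ) volume :=
    ((continuous_const.inner hccφ).integrable_of_hasCompactSupport
      (hccφc.mono fun x hx => by
        rw [mem_support] at hx ⊢
        contrapose! hx
        rw [hx, inner_zero_right]))
  unfold A1
  rw [h1]
  simp_rw [inner_sub_left]
  rw [integral_sub i1 i2, h2, sub_zero]

/-! ## Second-order rescaling -/

/-- `curl curl (Ψ(R⁻¹·))(x) = R⁻¹·R⁻¹·(curl curl Ψ)(R⁻¹x)`. [folklore] -/
theorem curl_curl_rescale (hΨ : ContDiff ℝ 2 Ψ) (R : ℝ) (x : E3) :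
    curl (curl fun y => Ψ (R⁻¹ • y)) x = R⁻¹ • (R⁻¹ • curl (curl Ψ) (R⁻¹ • x)) := by
  have hΨd : Differentiable ℝ Ψ := hΨ.differentiable (by norm_num)
  have hcd : Differentiable ℝ (curl Ψ) := (contDiff_curl (n := 1) hΨ).differentiable one_ne_zero
  have e : (curl fun y => Ψ (R⁻¹ • y)) = R⁻¹ • fun y => curl Ψ (R⁻¹ • y) := by
    funext y; rw [curl_rescale hΨd R y]; rfl
  have hd : Differentiable ℝ fun y => curl Ψ (R⁻¹ • y) := fun y => (hasFDerivAt_rescale hcd R y).differentiableAt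
  rw [e, curl_smul_pi hd, Pi.smul_apply, curl_rescale hcd R x]

/-! ## The distributional form of the blow-down pairing law -/

/-- **Blow-down pairing law, curl-curl form.**  Under the hypotheses of `tendsto_blowDown_pairing`, for any constant `c`:
**`κ⋆²M²W · R⁻²∫⟪v x − c, (curl curl Ψ)(R⁻¹x)⟫dx → −∫⟪v x, Ψ 0⟫dμ`**. [folklore] -/
theorem tendsto_blowDown_curlCurl_pairing (hv : ContDiff ℝ ∞ v) {M : ℝ} (hM : ∀ x, ‖v x‖ = M)
    (h1 : ∫⁻ x, ‖iteratedFDeriv ℝ 1 v x‖ₑ ^ 2 < ⊤) (h2 : ∫⁻ x, ‖iteratedFDeriv ℝ 2 v x‖ₑ ^ 2 < ⊤)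
    (μ : Measure E3) [IsFiniteMeasure μ]
    (hμ : ∀ φ : E3 → E3, ContDiff ℝ ∞ φ → HasCompactSupport φ → VectorCalculus.IsDivFree φ →
      Jst v * J1 v φ - kStar ^ 2 * M ^ 2 * (Wpa v * A1 v φ + Zen v * C1 v φ) = ∫ x, ⟪v x, φ x⟫_ℝ ∂μ)
    (hΨ : ContDiff ℝ ∞ Ψ) (hΨc : HasCompactSupport Ψ) (hΨdiv : VectorCalculus.IsDivFree Ψ) (c : E3) :
    Tendsto (fun R : ℝ => kStar ^ 2 * M ^ 2 * Wpa v * (R⁻¹ * R⁻¹ * ∫ x, ⟪v x - c, curl (curl Ψ) (R⁻¹ • x)⟫_ℝ)) atTop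
      (𝓝 (-∫ x, ⟪v x, Ψ 0⟫_ℝ ∂μ)) := by
  have h := tendsto_blowDown_pairing hv hM h1 h2 μ hμ hΨ hΨc hΨdiv
  refine h.congr' ((eventually_gt_atTop 0).mono fun R hR => ?_)
  have hφ : ContDiff ℝ ∞ (fun y => Ψ (R⁻¹ • y)) := contDiff_rescale hΨ R
  have hφc : HasCompactSupport (fun y => Ψ (R⁻¹ • y)) := hasCompactSupport_rescale hΨc hR.ne'
  show kStar ^ 2 * M ^ 2 * Wpa v * A1 v (fun y => Ψ (R⁻¹ • y)) =
    kStar ^ 2 * M ^ 2 * Wpa v * (R⁻¹ * R⁻¹ * ∫ x, ⟪v x - c, curl (curl Ψ) (R⁻¹ • x)⟫_ℝ)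
  rw [A1_eq_integral_inner_sub_curl_curl hv hφ hφc c]
  congr 1
  rw [← integral_const_mul]
  refine integral_congr_ae (Eventually.of_forall fun x => ?_)
  show ⟪v x - c, curl (curl fun y => Ψ (R⁻¹ • y)) x⟫_ℝ = R⁻¹ * R⁻¹ * ⟪v x - c, curl (curl Ψ) (R⁻¹ • x)⟫_ℝ
  rw [curl_curl_rescale (hΨ.of_le (by norm_cast)) R x, inner_smul_right, inner_smul_right, mul_assoc]

/-- **Blow-down pairing law, Laplacian form** (`Ψ` divergence free, `curl curl Ψ = −ΔΨ`):
**`κ⋆²M²W · R⁻²∫⟪v x − c, (ΔΨ)(R⁻¹x)⟫dx → ∫⟪v x, Ψ 0⟫dμ = ⟪Ψ(0), b⟫`** — with `V_R(y) = R·(v − c)(Ry)` this reads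
`κ⋆²M²W ∫⟪V_R, ΔΨ⟫ → ⟪b, Ψ(0)⟫`: `κ⋆²M²W·ΔV_R → b·δ₀` in `𝒟′` modulo gradients (the Stokeslet law). [folklore] -/
theorem tendsto_blowDown_laplacian_pairing (hv : ContDiff ℝ ∞ v) {M : ℝ} (hM : ∀ x, ‖v x‖ = M)
    (h1 : ∫⁻ x, ‖iteratedFDeriv ℝ 1 v x‖ₑ ^ 2 < ⊤) (h2 : ∫⁻ x, ‖iteratedFDeriv ℝ 2 v x‖ₑ ^ 2 < ⊤)
    (μ : Measure E3) [IsFiniteMeasure μ]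
    (hμ : ∀ φ : E3 → E3, ContDiff ℝ ∞ φ → HasCompactSupport φ → VectorCalculus.IsDivFree φ →
      Jst v * J1 v φ - kStar ^ 2 * M ^ 2 * (Wpa v * A1 v φ + Zen v * C1 v φ) = ∫ x, ⟪v x, φ x⟫_ℝ ∂μ)
    (hΨ : ContDiff ℝ ∞ Ψ) (hΨc : HasCompactSupport Ψ) (hΨdiv : VectorCalculus.IsDivFree Ψ) (c : E3) :
    Tendsto (fun R : ℝ => kStar ^ 2 * M ^ 2 * Wpa v * (R⁻¹ * R⁻¹ * ∫ x, ⟪v x - c, (Δ Ψ) (R⁻¹ • x)⟫_ℝ)) atTop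
      (𝓝 (∫ x, ⟪v x, Ψ 0⟫_ℝ ∂μ)) := by
  have h := (tendsto_blowDown_curlCurl_pairing hv hM h1 h2 μ hμ hΨ hΨc hΨdiv c).neg
  rw [neg_neg] at h
  refine h.congr' (Eventually.of_forall fun R => ?_)
  show -(kStar ^ 2 * M ^ 2 * Wpa v * (R⁻¹ * R⁻¹ * ∫ x, ⟪v x - c, curl (curl Ψ) (R⁻¹ • x)⟫_ℝ)) =
    kStar ^ 2 * M ^ 2 * Wpa v * (R⁻¹ * R⁻¹ * ∫ x, ⟪v x - c, (Δ Ψ) (R⁻¹ • x)⟫_ℝ)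
  have e : (∫ x, ⟪v x - c, curl (curl Ψ) (R⁻¹ • x)⟫_ℝ) = -∫ x, ⟪v x - c, (Δ Ψ) (R⁻¹ • x)⟫_ℝ := by
    rw [← integral_neg]
    refine integral_congr_ae (Eventually.of_forall fun x => ?_)
    show ⟪v x - c, curl (curl Ψ) (R⁻¹ • x)⟫_ℝ = -⟪v x - c, (Δ Ψ) (R⁻¹ • x)⟫_ℝ
    rw [curl_curl_eq_neg_laplacian (hΨ.of_le (by norm_cast)) hΨdiv, inner_neg_right]
  rw [e]; ring

/-- **The Stokeslet law for the residue object** (inputs discharged by g3's `exists_multiplierMeasure`): for `v` smooth,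
divergence free, `‖v‖ ≡ M > 0`, `‖Dv‖ ≤ B`, `D¹v, D²v ∈ L²`, extremal, there is a finite measure `μ` (the KKT multiplier, mass
`≤ κ⋆²ZW`) with barycentre `b = ∫v dμ` such that for every constant `c` and every solenoidal `Ψ ∈ C_c^∞`:
**`κ⋆²M²W · R⁻²∫⟪v x − c, (ΔΨ)(R⁻¹x)⟫dx → ⟪Ψ(0), b⟫`.** [folklore] -/
theorem residue_blowDown_stokeslet (hv : ContDiff ℝ ∞ v) (hdiv : VectorCalculus.IsDivFree v) {M B : ℝ}
    (hMpos : 0 < M) (hM : ∀ x, ‖v x‖ = M) (hB : ∀ x, ‖fderiv ℝ v x‖ ≤ B)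
    (h1 : ∫⁻ x, ‖iteratedFDeriv ℝ 1 v x‖ₑ ^ 2 < ⊤) (h2 : ∫⁻ x, ‖iteratedFDeriv ℝ 2 v x‖ₑ ^ 2 < ⊤)
    (hatt : |Jst v| = kStar * M * Real.sqrt (Zen v) * Real.sqrt (Wpa v)) :
    ∃ μ : Measure E3, IsFiniteMeasure μ ∧ μ univ ≤ ENNReal.ofReal (kStar ^ 2 * Zen v * Wpa v) ∧
      (∀ φ : E3 → E3, ContDiff ℝ ∞ φ → HasCompactSupport φ → VectorCalculus.IsDivFree φ →
        Jst v * J1 v φ - kStar ^ 2 * M ^ 2 * (Wpa v * A1 v φ + Zen v * C1 v φ) = ∫ x, ⟪v x, φ x⟫_ℝ ∂μ) ∧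
      ∀ (c : E3) (Ψ : E3 → E3), ContDiff ℝ ∞ Ψ → HasCompactSupport Ψ → VectorCalculus.IsDivFree Ψ →
        Tendsto (fun R : ℝ => kStar ^ 2 * M ^ 2 * Wpa v * (R⁻¹ * R⁻¹ * ∫ x, ⟪v x - c, (Δ Ψ) (R⁻¹ • x)⟫_ℝ))
          atTop (𝓝 ⟪Ψ 0, ∫ x, v x ∂μ⟫_ℝ) := by
  obtain ⟨μ, hfin, hmass, hμ⟩ := exists_multiplierMeasure hv hdiv hMpos hM hB h1 h2 hatt
  haveI := hfin
  refine ⟨μ, hfin, hmass, hμ, fun c Ψ hΨ hΨc hΨdiv => ?_⟩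
  have hvi : Integrable v μ :=
    (integrable_const M).mono' hv.continuous.aestronglyMeasurable (Eventually.of_forall fun x => (hM x).le)
  have e : (∫ x, ⟪v x, Ψ 0⟫_ℝ ∂μ) = ⟪Ψ 0, ∫ x, v x ∂μ⟫_ℝ := by
    rw [← integral_inner hvi]
    exact integral_congr_ae (Eventually.of_forall fun x => real_inner_comm _ _)
  rw [← e]
  exact tendsto_blowDown_laplacian_pairing hv hM h1 h2 μ hμ hΨ hΨc hΨdiv c

end ExtremiserLiouville

end Summit.NavierStokesRegularity.NavierStokesRegularity.Theorems

end
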